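import Mathlib

/-!
# Crux `PerpetualPump.AveragedTypeIBlowup` (stmt-NavierStokesRegularity-1835), line `Sketch`:
# stub `parameters` — the parameter cascade of the staircase

This file proves the registered Mathlib-only stub `stub_parameters` of the line's skeleton,
verbatim. The staircase of the perpetual pump is pinned by intermediate-value nesting over a
window `[lo, hi]` of front amplitudes; one step maps an amplitude `B` to some
`B' ∈ [g₋(B), g₊(B)]`, `g₊(B) = q(B + log(10(F+2)ε̄B) + 25)`, `g₋(B) = q(B + log ε̄ − 6 log(B+2) − 58)`,
`q = (1 + ε₀)^{1/2}`. The one-step theorem needs its regime on the range `[blo, bhi]`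
(`ε̄ ≤ 10⁻⁶`, `blo = 10⁴ + 40 − 5 log ε̄`, `F = 10⁹(bhi+4)⁴`, `ε̄·10⁹(F+1)²(bhi+4)³ ≤ 1`,
`10³ + 20 log(bhi+5) + log(F+2) ≤ −log ε̄`, the wavelet conditions on `θ(r)`, `η(r)`), the nesting
needs the two edge conditions, and the range must contain the images of the window.

The choice made here: `κ₀ = q/(q-1)` (so `(q-1)κ₀ = q`, `κ₀ ≥ 40`), `M = 10⁸κ₀`, `ε̄ = e^{-M}`,
`hi = 2κ₀M`, `lo = κ₀M/2`, `bhi = q·hi + 3`, `blo = 10⁴ + 40 + 5M`, `F = 10⁹(bhi+4)⁴`,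
`r = ρ₀/(4K)` with `ρ₀ = 1 + ε₀/4`, `K = 10⁹(bhi+4)⁴(F+1)`. Every constraint is then a comparison
of `log M` (or of a power of `M` against `e^M`) with `M`, settled by the single elementary bound
`log M ≤ M/a + a − 2` (`a > 0`), i.e. `log M ≤ 10⁻⁴ M` for `M ≥ 10⁹`.

Nothing here closes the item (`--supports`); no statement of the route changes.

## References

* T. Tao, *Finite time blowup for an averaged three-dimensional Navier–Stokes equation*,
  J. Amer. Math. Soc. 29 (2016), 601–674, arXiv:1402.0290v3, §5–§6 (the choice of parameters of
  the cascade). Only elementary real inequalities are used here.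
-/

noncomputable section

-- the summit namespace `…NavierStokesRegularity.NavierStokesRegularity…` is the tree convention
set_option linter.dupNamespace false

open MeasureTheory Set Filter Topology
open scoped ENNReal

namespace Summit.NavierStokesRegularity.NavierStokesRegularity.Theorems.PerpetualPumpAveragedTypeIBlowup

/-- Log versus linear: `log M ≤ M/a + a − 2` for all `M, a > 0` (the bound `log x ≤ x − 1` at
`x = M/a` and at `x = a`). [folklore] -/
theorem params_log_le_div_add {M a : ℝ} (hM : 0 < M) (ha : 0 < a) :
    Real.log M ≤ M / a + a - 2 := by
  have h1 := Real.log_le_sub_one_of_pos (div_pos hM ha)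
  have h2 := Real.log_le_sub_one_of_pos ha
  rw [Real.log_div hM.ne' ha.ne'] at h1
  linarith

/-- The working form of the log-versus-linear bound: `0 ≤ log M ≤ 10⁻⁴ M` for `M ≥ 10⁹`.
[folklore] -/
theorem params_log_small {M : ℝ} (hM9 : 10 ^ 9 ≤ M) :
    Real.log M ≤ M / 10 ^ 4 ∧ 0 ≤ Real.log M := by
  have := params_log_le_div_add (by linarith : (0 : ℝ) < M) (show (0 : ℝ) < 2 * 10 ^ 4 by norm_num)
  exact ⟨by linarith, Real.log_nonneg (by linarith)⟩

/-- Powers below the exponential: `M ^ n ≤ exp M` as soon as `n · log M ≤ M` (`M > 0`).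
[folklore] -/
theorem params_pow_le_exp {M : ℝ} (n : ℕ) (hM : 0 < M) (h : (n : ℝ) * Real.log M ≤ M) :
    M ^ n ≤ Real.exp M := by
  calc M ^ n = Real.exp (Real.log M) ^ n := by rw [Real.exp_log hM]
    _ = Real.exp (n * Real.log M) := (Real.exp_nat_mul _ _).symm
    _ ≤ Real.exp M := Real.exp_le_exp.mpr h

/-- The geometric ratio `q = (1 + ε₀)^{1/2}` of the staircase, `0 < ε₀ ≤ 1/20`:
`1 < q < 41/40` and `q² = 1 + ε₀`. [folklore] -/
theorem params_ratio_bounds {ε₀ q : ℝ} (hε₀ : 0 < ε₀) (hε₀' : ε₀ ≤ 1 / 20)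
    (hq : q = Real.sqrt (1 + ε₀)) : 1 < q ∧ q < 41 / 40 ∧ q ^ 2 = 1 + ε₀ := by
  subst hq
  exact ⟨(Real.lt_sqrt (by norm_num)).2 (by linarith), (Real.sqrt_lt' (by norm_num)).2 (by linarith),
    Real.sq_sqrt (by linarith)⟩

/-- The wavelet radius of the cascade: for `ρ > 0`, `K ≥ 1` and `r = ρ/(4K)` one has
`0 < r ≤ ρ/2`, `θ(r) = (ρ − r)²/(ρ² + r²) ∈ [1/2, 1]`, `η(r) = 2ρr/(ρ² + r²) ≥ 0` and
`η(r)·K ≤ 1`. [folklore] -/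
theorem params_radius {ρ K : ℝ} (hρ : 0 < ρ) (hK : 1 ≤ K) (r : ℝ) (hr : r = ρ / (4 * K)) :
    0 < r ∧ r ≤ ρ / 2 ∧ 1 / 2 ≤ (ρ - r) ^ 2 / (ρ ^ 2 + r ^ 2) ∧
      (ρ - r) ^ 2 / (ρ ^ 2 + r ^ 2) ≤ 1 ∧ 0 ≤ 2 * ρ * r / (ρ ^ 2 + r ^ 2) ∧
      2 * ρ * r / (ρ ^ 2 + r ^ 2) * K ≤ 1 := by
  have hK0 : 0 < K := by linarith
  have hKne : K ≠ 0 := hK0.ne'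
  have hr0 : 0 < r := by rw [hr]; positivity
  have hr4 : r ≤ ρ / 4 := by
    rw [hr]; exact div_le_div_of_nonneg_left hρ.le (by norm_num) (by linarith)
  have hrK : r * K = ρ / 4 := by rw [hr, div_mul_eq_mul_div, mul_div_mul_right _ _ hKne]
  have hden : 0 < ρ ^ 2 + r ^ 2 := by positivity
  refine ⟨hr0, by linarith, ?_, ?_, by positivity, ?_⟩
  · rw [le_div_iff₀ hden]; nlinarith [mul_le_mul_of_nonneg_left hr4 hρ.le, sq_nonneg r]
  · rw [div_le_one hden]; nlinarith [mul_pos hρ hr0]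
  · rw [div_mul_eq_mul_div, div_le_one hden]
    have : 2 * ρ * r * K = ρ ^ 2 / 2 := by linear_combination 2 * ρ * hrK
    nlinarith [sq_nonneg r, sq_nonneg ρ]

/-- The sizes of the window and of the range: with `κ₀(q-1) = q`, `κ₀ ≥ 40`, `M = 10⁸κ₀`,
`hi = 2κ₀M`, `lo = κ₀M/2`, `bhi = q·hi + 3` one has `M ≥ 10⁹`, `q·lo = lo + qM/2`,
`q·hi = hi + 2qM`, `lo ≥ 20M`, `hi = 4lo ≤ M²/10`, `4 ≤ bhi + 4 ≤ M²`. [folklore] -/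
theorem params_window_sizes {q κ₀ M lo hi bhi : ℝ} (hq1 : 1 < q) (hq2 : q < 41 / 40)
    (hκq : κ₀ * (q - 1) = q) (hκ40 : 40 ≤ κ₀) (hM : M = 10 ^ 8 * κ₀) (hhi : hi = 2 * κ₀ * M)
    (hlo : lo = κ₀ * M / 2) (hbhi : bhi = q * hi + 3) :
    10 ^ 9 ≤ M ∧ M ≤ q * M ∧ q * lo = lo + q * M / 2 ∧ q * hi = hi + 2 * q * M ∧ 20 * M ≤ lo ∧
      hi = 4 * lo ∧ hi ≤ M ^ 2 / 10 ∧ 4 ≤ bhi + 4 ∧ bhi + 4 ≤ M ^ 2 := by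
  have hM9 : (10 : ℝ) ^ 9 ≤ M := by rw [hM]; linarith
  have hM0 : 0 < M := by linarith
  have hκM : κ₀ * M = M ^ 2 / 10 ^ 8 := by rw [hM]; ring
  have hM18 : (10 : ℝ) ^ 18 ≤ M ^ 2 := by nlinarith [mul_le_mul hM9 hM9 (by norm_num) hM0.le]
  have hhiM2 : hi ≤ M ^ 2 / 10 := by rw [hhi, mul_assoc, hκM]; nlinarith [sq_nonneg M]
  have hhi0 : 0 ≤ hi := by rw [hhi, mul_assoc, hκM]; positivity
  have hloM : 20 * M ≤ lo := by rw [hlo]; nlinarith [mul_le_mul_of_nonneg_right hκ40 hM0.le]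
  refine ⟨hM9, le_mul_of_one_le_left hM0.le hq1.le, by rw [hlo]; linear_combination (M / 2) * hκq,
    by rw [hhi]; linear_combination (2 * M) * hκq, hloM, by rw [hhi, hlo]; ring, hhiM2, ?_, ?_⟩
  · rw [hbhi]; nlinarith [mul_nonneg (by linarith : (0 : ℝ) ≤ q) hhi0]
  · rw [hbhi]; nlinarith [mul_le_mul_of_nonneg_right hq2.le hhi0, hM18, hhiM2]

/-- The amplification constant: with `M ≥ 10⁹`, `log M ≤ 10⁻⁴M`, `4 ≤ A ≤ M²`, `F = 10⁹A⁴` one has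
`F + 2 ≤ M¹⁰`, `10⁹(F+1)²A³ ≤ M²⁷ ≤ e^M` and `10⁹A⁴(F+1) ≥ 1`. [folklore] -/
theorem params_amplification {M A F : ℝ} (hM9 : 10 ^ 9 ≤ M) (hlog : Real.log M ≤ M / 10 ^ 4)
    (hA4 : 4 ≤ A) (hA : A ≤ M ^ 2) (hF : F = 10 ^ 9 * A ^ 4) :
    0 ≤ F ∧ F + 2 ≤ M ^ 10 ∧ 10 ^ 9 * (F + 1) ^ 2 * A ^ 3 ≤ Real.exp M ∧
      1 ≤ 10 ^ 9 * A ^ 4 * (F + 1) := by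
  have hM0 : 0 < M := by linarith
  have hA0 : 0 ≤ A := by linarith
  have hM18 : (10 : ℝ) ^ 18 ≤ M ^ 2 := by nlinarith [mul_le_mul hM9 hM9 (by norm_num) hM0.le]
  have hF0 : 0 ≤ F := by rw [hF]; positivity
  have hF10 : F + 2 ≤ M ^ 10 := by
    have h8 : 1 ≤ M ^ 8 := one_le_pow₀ (by linarith)
    have h4 : A ^ 4 ≤ (M ^ 2) ^ 4 := pow_le_pow_left₀ hA0 hA 4
    calc F + 2 = 10 ^ 9 * A ^ 4 + 2 := by rw [hF]
      _ ≤ 10 ^ 9 * (M ^ 2) ^ 4 + 2 := by linarith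
      _ = 10 ^ 9 * M ^ 8 + 2 := by ring
      _ ≤ 10 ^ 10 * M ^ 8 := by linarith
      _ ≤ M ^ 2 * M ^ 8 :=
          mul_le_mul_of_nonneg_right (le_trans (by norm_num) hM18) (pow_nonneg hM0.le 8)
      _ = M ^ 10 := by ring
  refine ⟨hF0, hF10, ?_, ?_⟩
  · have h1 : (F + 1) ^ 2 ≤ (M ^ 10) ^ 2 := pow_le_pow_left₀ (by linarith) (by linarith) 2
    have h2 : A ^ 3 ≤ (M ^ 2) ^ 3 := pow_le_pow_left₀ hA0 hA 3
    calc 10 ^ 9 * (F + 1) ^ 2 * A ^ 3 ≤ 10 ^ 9 * (M ^ 10) ^ 2 * (M ^ 2) ^ 3 :=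
          mul_le_mul (mul_le_mul_of_nonneg_left h1 (by norm_num)) h2 (pow_nonneg hA0 3)
            (by positivity)
      _ = 10 ^ 9 * M ^ 26 := by ring
      _ ≤ M * M ^ 26 :=
          mul_le_mul_of_nonneg_right (le_trans (by norm_num) hM9) (pow_nonneg hM0.le 26)
      _ = M ^ 27 := by ring
      _ ≤ Real.exp M := params_pow_le_exp 27 hM0 (by push_cast; linarith)
  · have h1 : 1 ≤ A ^ 4 := one_le_pow₀ (by linarith)
    have h2 : 1 ≤ F + 1 := by linarith
    have h12 := mul_le_mul h1 h2 zero_le_one (zero_le_one.trans h1)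
    rw [mul_assoc]; linarith

/-- Logarithms on the window: for `B ∈ [lo − 3, hi]` (`lo ≥ 20M`, `hi ≤ M²/10`, `F + 2 ≤ M¹⁰`,
`log ε̄ = −M`, `log M ≤ 10⁻⁴M`) one has `log(10(F+2)ε̄B) ≤ 12·10⁻⁴M − M` and
`log(B+2) ≤ 2·10⁻⁴M`. [folklore] -/
theorem params_window_logs {M F εb lo hi : ℝ} (hM9 : 10 ^ 9 ≤ M) (hlog : Real.log M ≤ M / 10 ^ 4)
    (hF0 : 0 ≤ F) (hF10 : F + 2 ≤ M ^ 10) (hεb0 : 0 < εb) (hlogεb : Real.log εb = -M)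
    (hloM : 20 * M ≤ lo) (hhiM2 : hi ≤ M ^ 2 / 10) (B : ℝ) (hB1 : lo - 3 ≤ B) (hB2 : B ≤ hi) :
    Real.log (10 * (F + 2) * εb * B) ≤ 12 * (M / 10 ^ 4) - M ∧
      Real.log (B + 2) ≤ 2 * (M / 10 ^ 4) := by
  have hM0 : 0 < M := by linarith
  have hM18 : (10 : ℝ) ^ 18 ≤ M ^ 2 := by nlinarith [mul_le_mul hM9 hM9 (by norm_num) hM0.le]
  have hB0 : 0 < B := by linarith
  have hF2 : 0 < F + 2 := by linarith
  constructor
  · have hprod : 10 * (F + 2) * εb * B = 10 * (F + 2) * B * εb := by ring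
    have hpos : 0 < 10 * (F + 2) * B := mul_pos (mul_pos (by norm_num) hF2) hB0
    rw [hprod, Real.log_mul hpos.ne' hεb0.ne', hlogεb]
    have h1 : Real.log (10 * (F + 2) * B) ≤ 12 * Real.log M := by
      calc Real.log (10 * (F + 2) * B) ≤ Real.log (M ^ 12) := by
            apply Real.log_le_log hpos
            calc 10 * (F + 2) * B ≤ 10 * M ^ 10 * (M ^ 2 / 10) :=
                  mul_le_mul (mul_le_mul_of_nonneg_left hF10 (by norm_num)) (hB2.trans hhiM2)
                    hB0.le (by positivity)
              _ = M ^ 12 := by ring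
        _ = 12 * Real.log M := by rw [Real.log_pow]; norm_num
    linarith
  · calc Real.log (B + 2) ≤ Real.log (M ^ 2) := Real.log_le_log (by linarith) (by linarith)
      _ = 2 * Real.log M := by rw [Real.log_pow]; norm_num
      _ ≤ 2 * (M / 10 ^ 4) := by linarith

/-- **Stub `parameters`** (Mathlib-only). THE PARAMETER CASCADE OF THE STAIRCASE: for every
`0 < ε₀ ≤ 1/20` (`q = (1+ε₀)^{1/2}`) there are a seed `ε̄ = e^{-M}`, an intermediate-value window
`[lo, hi]`, a one-step range `[blo, bhi] ⊇ [lo − 3, hi] ∪ g±([lo−3, hi])`, the bond amplification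
constant `F = 10⁹(bhi+4)⁴` and a wavelet radius `r`, satisfying the regime of the window one-step
theorem and the two EDGE CONDITIONS of the nesting (`g₊(B) + 3 < lo` for `B ∈ [lo−3, lo]`,
`g₋(B) > hi` for `B ∈ [hi−3, hi]`, where `g₊(B) = q(B + log(10(F+2)ε̄B) + 25)`,
`g₋(B) = q(B + log ε̄ − 6 log(B+2) − 58)` are the one-sided growth bounds of one step).
Choice: `hi = 2κ₀M`, `lo = κ₀M/2`, `κ₀ = q/(q−1)`, `M = 10⁸κ₀`, `blo = 10⁴ + 40 + 5M`,
`bhi = q·hi + 3`, `r = ρ₀/(4·10⁹(bhi+4)⁴(F+1))`. [folklore] -/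
theorem stub_parameters :
    ∀ (ε₀ q : ℝ), 0 < ε₀ → ε₀ ≤ 1 / 20 → q = Real.sqrt (1 + ε₀) →
      ∃ (M εb lo hi blo bhi F r : ℝ),
        εb = Real.exp (-M) ∧ 0 < εb ∧ εb ≤ 1 / 10 ^ 6 ∧ F = 10 ^ 9 * (bhi + 4) ^ 4 ∧
        blo = 10 ^ 4 + 40 - 5 * Real.log εb ∧ 10 ^ 4 ≤ blo ∧ blo ≤ lo - 3 ∧ lo + 3 ≤ hi ∧ hi ≤ bhi ∧
        εb * (10 ^ 9 * (F + 1) ^ 2 * (bhi + 4) ^ 3) ≤ 1 ∧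
        10 ^ 3 + 20 * Real.log (bhi + 5) + Real.log (F + 2) ≤ -Real.log εb ∧
        (∀ B : ℝ, lo - 3 ≤ B → B ≤ hi →
          blo ≤ q * (B + Real.log εb - 6 * Real.log (B + 2) - 58) ∧
          q * (B + Real.log (10 * (F + 2) * εb * B) + 25) ≤ bhi) ∧
        (∀ B : ℝ, lo - 3 ≤ B → B ≤ lo → q * (B + Real.log (10 * (F + 2) * εb * B) + 25) + 3 < lo) ∧
        (∀ B : ℝ, hi - 3 ≤ B → B ≤ hi → hi < q * (B + Real.log εb - 6 * Real.log (B + 2) - 58)) ∧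
        0 < r ∧ r ≤ (1 + ε₀ / 4) / 2 ∧
        1 / 2 ≤ (1 + ε₀ / 4 - r) ^ 2 / ((1 + ε₀ / 4) ^ 2 + r ^ 2) ∧
        (1 + ε₀ / 4 - r) ^ 2 / ((1 + ε₀ / 4) ^ 2 + r ^ 2) ≤ 1 ∧
        0 ≤ 2 * (1 + ε₀ / 4) * r / ((1 + ε₀ / 4) ^ 2 + r ^ 2) ∧
        2 * (1 + ε₀ / 4) * r / ((1 + ε₀ / 4) ^ 2 + r ^ 2) * (10 ^ 9 * (bhi + 4) ^ 4 * (F + 1)) ≤ 1 := by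
  intro ε₀ q hε₀ hε₀' hq
  obtain ⟨hq1, hq2, _⟩ := params_ratio_bounds hε₀ hε₀' hq
  have hq0 : 0 < q := by linarith
  have hqm1 : 0 < q - 1 := by linarith
  -- the nesting ratio `κ₀ = q/(q-1) ≥ 40`, `(q-1)κ₀ = q`
  obtain ⟨κ₀, hκ₀⟩ : ∃ κ₀ : ℝ, κ₀ = q / (q - 1) := ⟨_, rfl⟩
  have hκq : κ₀ * (q - 1) = q := by rw [hκ₀]; field_simp
  have hκ40 : 40 ≤ κ₀ := by rw [hκ₀, le_div_iff₀ hqm1]; linarith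
  -- the size `M`, the seed `ε̄`, the window, the range, the constants `F`, `K`, the radius `r`
  obtain ⟨M, hM⟩ : ∃ M : ℝ, M = 10 ^ 8 * κ₀ := ⟨_, rfl⟩
  obtain ⟨εb, hεb⟩ : ∃ εb : ℝ, εb = Real.exp (-M) := ⟨_, rfl⟩
  obtain ⟨hi, hhi⟩ : ∃ hi : ℝ, hi = 2 * κ₀ * M := ⟨_, rfl⟩
  obtain ⟨lo, hlo⟩ : ∃ lo : ℝ, lo = κ₀ * M / 2 := ⟨_, rfl⟩
  obtain ⟨bhi, hbhi⟩ : ∃ bhi : ℝ, bhi = q * hi + 3 := ⟨_, rfl⟩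
  obtain ⟨blo, hblo⟩ : ∃ blo : ℝ, blo = 10 ^ 4 + 40 - 5 * Real.log εb := ⟨_, rfl⟩
  obtain ⟨F, hF⟩ : ∃ F : ℝ, F = 10 ^ 9 * (bhi + 4) ^ 4 := ⟨_, rfl⟩
  obtain ⟨K, hK⟩ : ∃ K : ℝ, K = 10 ^ 9 * (bhi + 4) ^ 4 * (F + 1) := ⟨_, rfl⟩
  obtain ⟨r, hr⟩ : ∃ r : ℝ, r = (1 + ε₀ / 4) / (4 * K) := ⟨_, rfl⟩
  obtain ⟨hM9, hqM, hqlo, hqhi, hloM, hhilo, hhiM2, hA4, hA⟩ :=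
    params_window_sizes hq1 hq2 hκq hκ40 hM hhi hlo hbhi
  clear hκ₀ hκq hκ40 hM hhi hlo
  obtain ⟨hlog, hlog0⟩ := params_log_small hM9
  have hεb0 : 0 < εb := by rw [hεb]; exact Real.exp_pos _
  have hlogεb : Real.log εb = -M := by rw [hεb, Real.log_exp]
  have hblo' : blo = 10040 + 5 * M := by rw [hblo, hlogεb]; ring
  obtain ⟨hF0, hF10, hX, hK1⟩ := params_amplification hM9 hlog hA4 hA hF
  rw [← hK] at hK1
  have hwin := params_window_logs hM9 hlog hF0 hF10 hεb0 hlogεb hloM hhiM2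
  obtain ⟨hr0, hr2, hθ1, hθ2, hη0, hη1⟩ :=
    params_radius (show (0 : ℝ) < 1 + ε₀ / 4 by linarith) hK1 r hr
  refine ⟨M, εb, lo, hi, blo, bhi, F, r, hεb, hεb0, ?_, hF, hblo, ?_, ?_, ?_, ?_, ?_, ?_, ?_, ?_, ?_,
    hr0, hr2, hθ1, hθ2, hη0, by rw [← hK]; exact hη1⟩
  · -- `ε̄ ≤ 10⁻⁶`
    rw [hεb, Real.exp_neg, ← one_div]
    exact one_div_le_one_div_of_le (by norm_num) (by linarith [Real.add_one_le_exp M])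
  · rw [hblo']; linarith
  · rw [hblo']; linarith
  · linarith
  · rw [hbhi]; linarith
  · -- `ε̄ · 10⁹ (F+1)² (bhi+4)³ ≤ 1`
    rw [hεb]
    calc Real.exp (-M) * (10 ^ 9 * (F + 1) ^ 2 * (bhi + 4) ^ 3)
        ≤ Real.exp (-M) * Real.exp M := mul_le_mul_of_nonneg_left hX (Real.exp_pos _).le
      _ = 1 := by rw [← Real.exp_add, neg_add_cancel, Real.exp_zero]
  · -- `10³ + 20 log(bhi+5) + log(F+2) ≤ M`
    rw [hlogεb, neg_neg]
    have hM3 : bhi + 5 ≤ M ^ 3 := by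
      nlinarith [mul_le_mul_of_nonneg_right (show (2 : ℝ) ≤ M by linarith) (sq_nonneg M)]
    have h1 : Real.log (bhi + 5) ≤ 3 * Real.log M := by
      calc Real.log (bhi + 5) ≤ Real.log (M ^ 3) := Real.log_le_log (by linarith) hM3
        _ = 3 * Real.log M := by rw [Real.log_pow]; norm_num
    have h2 : Real.log (F + 2) ≤ 10 * Real.log M := by
      calc Real.log (F + 2) ≤ Real.log (M ^ 10) := Real.log_le_log (by linarith) hF10
        _ = 10 * Real.log M := by rw [Real.log_pow]; norm_num
    linarith
  · -- the range contains the images of the window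
    intro B hB1 hB2
    obtain ⟨hl1, hl2⟩ := hwin B hB1 hB2
    rw [hblo', hlogεb, hbhi]
    constructor
    · have hX0 : 0 ≤ B + -M - 6 * Real.log (B + 2) - 58 := by linarith
      have := le_mul_of_one_le_left hX0 hq1.le
      linarith
    · have h1 : B + Real.log (10 * (F + 2) * εb * B) + 25 ≤ hi := by linarith
      have := mul_le_mul_of_nonneg_left h1 hq0.le
      linarith
  · -- edge condition at `lo`
    intro B hB1 hB2
    have hB3 : B ≤ hi := by linarith
    obtain ⟨hl1, _⟩ := hwin B hB1 hB3
    have h1 : B + Real.log (10 * (F + 2) * εb * B) + 25 ≤ lo + (12 * (M / 10 ^ 4) - M) + 25 := by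
      linarith
    have h2 := mul_le_mul_of_nonneg_left h1 hq0.le
    have h3 : q * (lo + (12 * (M / 10 ^ 4) - M) + 25)
        = q * lo + (12 / 10 ^ 4 - 1) * (q * M) + 25 * q := by ring
    linarith
  · -- edge condition at `hi`
    intro B hB1 hB2
    have hB3 : lo - 3 ≤ B := by linarith
    obtain ⟨_, hl2⟩ := hwin B hB3 hB2
    rw [hlogεb]
    have h1 : hi - 3 + -M - 6 * (2 * (M / 10 ^ 4)) - 58 ≤ B + -M - 6 * Real.log (B + 2) - 58 := by
      linarith
    have h2 := mul_le_mul_of_nonneg_left h1 hq0.le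
    have h3 : q * (hi - 3 + -M - 6 * (2 * (M / 10 ^ 4)) - 58)
        = q * hi - (1 + 12 / 10 ^ 4) * (q * M) - 61 * q := by ring
    linarith

end Summit.NavierStokesRegularity.NavierStokesRegularity.Theorems.PerpetualPumpAveragedTypeIBlowup

end
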